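import Summits.QuantumFields.QCD.Theses.NestedDissectionSea
import Summits.QuantumFields.QCD.Theorems.EarlyCrosserLaw.Negative.CellPositivityDomain
import Summits.QuantumFields.QCD.Theorems.NestedDissectionSeaEarlyCrosserLawStubCrossingCharge
import Summits.QuantumFields.QCD.Theorems.NestedDissectionSeaEarlyCrosserLawStubExcessRegular
import Literature.MathematicalPhysics.QuantumFieldTheory.QCDPhaseQuenched

/-!
# Reduction of the crux `EarlyCrosserLaw` (stmt-QuantumFields-13995) to its two physics statements
(line `accretive-coarse-jensen`, lead prover-line-stmt-QuantumFields-13995-0, 2026-08-16)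

Sorry-free, definition-free companion of the registered skeleton `Cruxes/EarlyCrosserLaw/Lines/accretive-coarse-jensen.lean`.
With the line's two deterministic stubs LANDED and imported (`stub_crossingCharge` p78628, `stub_excessRegular` p84131),
`Summit.QuantumFields.QCD.Theses.NestedDissectionSea.EarlyCrosserLaw` is a kernel-checked consequence of two named physics
statements, taken here as explicit hypotheses whose texts are the registered stub signatures `stub_pinnedLine` /
`stub_jensenDilution` verbatim (tree vocabulary only):
* `dilution_of_jensenLaw` — core: at fixed `(reg, b₀, ℓ, m, R)` the Jensen law implies clause (a′) of the crux (window
  dilution of early crossers): a cover event forces a crossing `μ' ∈ [m_f(k), 0]` of the window cell or a child (upper end: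
  landed positivity domain `wilsonCell_det_ne_zero_of_pos`), the grid disc `n = ⌊−μ'/2r_f⌋₊` is charged `log 2`
  (`stub_crossingCharge`), every other term is `≥ 0`, bounded, measurable (`stub_excessRegular`), and Markov for the OUTER
  phase-quenched probability (`outerProb_le_of_charge`; junk-safe: non-integrable numerator ⇒ `0`, `x/0 = 0`) closes.
* `EarlyCrosserLaw_of_pinnedLine_of_jensenDilution` — FORM A, the registered cut: shared TWO-SIDED PARITY PIN ((b) ∧ (b″) with
  its own `∃ reg`; Yang–Mills topology) + JENSEN DILUTION asked of EVERY admissible regularisation at which the pins hold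
  (equivalently, up to a factor 2 as `r → 0`, a window-summable bound on the mean NUMBER of real eigenvalues of the massless
  Dirichlet cell operators in the early segment — drefute report `Cruxes/EarlyCrosserLaw/JensenDilution-drefute.md`, whose
  design flag is recorded: a proof of the ∀-reg form must also refute pins placed at a hypothetical wrong line inside the
  Wilson band, i.e. prove a (b)-type parity lower bound there).
* `EarlyCrosserLaw_of_pinnedJensen` — FORM B, the ∃-merged cut: ONE regularisation carrying pins and Jensen law at its own
  line (no uniqueness of the parity up-jump imported; the shared pin is no longer a separate node).
Planners may read either form as the glue of a glued split of the crux (D-0019).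
-/

noncomputable section

open scoped BigOperators Matrix ComplexConjugate
open Filter MeasureTheory
open Literature.MathematicalPhysics.QuantumLattice Literature.MathematicalPhysics.QuantumFieldTheory
  Literature.Probability.LatticeModels
open Summit.QuantumFields.QCD.Theses.NestedDissectionSea

namespace Summit.QuantumFields.QCD.Cruxes.EarlyCrosserLaw.AccretiveCoarseJensen

open scoped Classical

/-- **Markov for the outer reweighted probability** (finite measure, measurable bounded weight `wt ≥ 0` and charge
`F ≥ 0`): if every point of an ARBITRARY event `E` carries charge `≥ L > 0` and the reweighted mean of `F` is `≤ δ L`, the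
reweighted OUTER probability of `E` (Bochner conventions: non-integrable ⇒ `∫ = 0`, `x / 0 = 0`) is `≤ δ`. [folklore] -/
theorem outerProb_le_of_charge {X : Type*} [MeasurableSpace X] (μ : Measure X) [IsFiniteMeasure μ]
    (wt F : X → ℝ) (hwt : Measurable wt) (hwt0 : ∀ U, 0 ≤ wt U) (Cw : ℝ) (hwtC : ∀ U, wt U ≤ Cw)
    (hF : Measurable F) (hF0 : ∀ U, 0 ≤ F U) (B : ℝ) (hFB : ∀ U, F U ≤ B)
    (E : X → Prop) [DecidablePred E] (L : ℝ) (hL : 0 < L) (hE : ∀ U, E U → L ≤ F U) (δ : ℝ)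
    (hbound : (∫ U, F U * wt U ∂μ) / (∫ U, wt U ∂μ) ≤ δ * L) :
    (∫ U, (if E U then (1 : ℝ) else 0) * wt U ∂μ) / (∫ U, wt U ∂μ) ≤ δ := by
  have hFwt_int : Integrable (fun U => F U * wt U) μ := by
    refine Integrable.of_bound (hF.mul hwt).aestronglyMeasurable (B * Cw)
      (Eventually.of_forall fun U => ?_)
    rw [Real.norm_eq_abs, abs_of_nonneg (mul_nonneg (hF0 U) (hwt0 U))]
    exact mul_le_mul (hFB U) (hwtC U) (hwt0 U) ((hF0 U).trans (hFB U))
  have hZ0 : 0 ≤ ∫ U, wt U ∂μ := integral_nonneg hwt0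
  have hb0 : 0 ≤ ∫ U, F U * wt U ∂μ := integral_nonneg fun U => mul_nonneg (hF0 U) (hwt0 U)
  have key : L * ∫ U, (if E U then (1 : ℝ) else 0) * wt U ∂μ ≤ ∫ U, F U * wt U ∂μ := by
    by_cases hint : Integrable (fun U => (if E U then (1 : ℝ) else 0) * wt U) μ
    · rw [← integral_const_mul]
      refine integral_mono (hint.const_mul L) hFwt_int fun U => ?_
      dsimp only
      by_cases hU : E U
      · rw [if_pos hU, one_mul]
        exact mul_le_mul_of_nonneg_right (hE U hU) (hwt0 U)
      · rw [if_neg hU, zero_mul, mul_zero]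
        exact mul_nonneg (hF0 U) (hwt0 U)
    · rw [integral_undef hint, mul_zero]
      exact hb0
  have h1 : ∫ U, (if E U then (1 : ℝ) else 0) * wt U ∂μ ≤ (∫ U, F U * wt U ∂μ) / L := by
    rw [le_div_iff₀ hL]
    linarith [key]
  calc (∫ U, (if E U then (1 : ℝ) else 0) * wt U ∂μ) / (∫ U, wt U ∂μ)
      ≤ ((∫ U, F U * wt U ∂μ) / L) / (∫ U, wt U ∂μ) := div_le_div_of_nonneg_right h1 hZ0
    _ = ((∫ U, F U * wt U ∂μ) / (∫ U, wt U ∂μ)) / L := by rw [div_right_comm]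
    _ ≤ δ := by rw [div_le_iff₀ hL]; exact hbound

/-! ## The core: the Jensen law at fixed data implies clause (a′) at the same data -/

/-- **Jensen law ⇒ clause (a′)** at fixed `(reg, b₀, ℓ, m, R)`, same `∀ε ∀ᶠk ∀S` prefix: a cover event forces a crossing
`μ' ∈ [m_f(k), 0]` of the corner-`0` window cell or a child (positivity domain), `−μ'` is within `r_f` of the grid centre
`(2n+1) r_f`, `n = ⌊−μ'/2r_f⌋₊ ≤ ⌊−m_f(k)/2r_f⌋₊`, that disc is charged `≥ log 2` (`stub_crossingCharge`), all other terms are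
`≥ 0`, bounded, measurable (`stub_excessRegular`), and `outerProb_le_of_charge` gives `P(E) ≤ δ_j`. -/
theorem dilution_of_jensenLaw {Nf : ℕ} (reg : QCDRegularisation Nf) (b₀ : ℕ) (ℓ : ℝ) (m : Fin Nf → ℝ)
    (R : ℝ)
    (hJL : (∀ ε : ℝ, 0 < ε → ∀ᶠ k : ℕ in Filter.atTop, ∀ S : ℕ, R ≤ reg.a k * (2 * S + 1) →
          ∃ δ : ℕ → ℝ, (∀ j, 0 ≤ δ j) ∧
            ∑ j ∈ Finset.range (Nat.log 2 (⌊ℓ / reg.a k⌋₊ / b₀) + 1), δ j ≤ ε ∧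
            ∀ j < Nat.log 2 (⌊ℓ / reg.a k⌋₊ / b₀) + 1, ∀ s : Fin 4 → ℕ,
              (∀ i, b₀ * 2 ^ j ≤ s i ∧ s i < b₀ * 2 ^ (j + 2) ∧ s i ≤ 2 * S + 1 ∧
                (s i : ℝ) * reg.a k ≤ ℓ) →
              ∃ r : Fin Nf → ℝ, (∀ f, 0 < r f) ∧
                (∫ U, (∑ f, ∑ n ∈ Finset.range
                    (⌊(-(reg.mcrit k + reg.a k * m f / reg.Zm k)) / (2 * r f)⌋₊ + 1),
                    ((Real.circleAverage (fun z : ℂ => Real.log ‖((wilsonCell U 0 (0 : TorusSite 4 (2 * S + 1)) s).charpoly).eval z‖)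
                        ((((2 * (n : ℝ) + 1) * r f : ℝ)) : ℂ) (2 * r f)
                      - Real.circleAverage (fun z : ℂ => Real.log ‖((wilsonCell U 0 (0 : TorusSite 4 (2 * S + 1)) s).charpoly).eval z‖)
                        ((((2 * (n : ℝ) + 1) * r f : ℝ)) : ℂ) (r f)) +
                      ∑ ε : Fin 4 → Bool,
                        (Real.circleAverage (fun z : ℂ => Real.log ‖((wilsonCell U 0 (halfCorner s ε) (halfSides s ε)).charpoly).eval z‖)
                        ((((2 * (n : ℝ) + 1) * r f : ℝ)) : ℂ) (2 * r f)
                      - Real.circleAverage (fun z : ℂ => Real.log ‖((wilsonCell U 0 (halfCorner s ε) (halfSides s ε)).charpoly).eval z‖)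
                        ((((2 * (n : ℝ) + 1) * r f : ℝ)) : ℂ) (r f)))) *
                    (∏ f, ‖fermionDet (wilsonDirac (fundamentalRep (Fin 3)) U (reg.mcrit k + reg.a k * m f / reg.Zm k) 1)‖)
                  ∂(wilsonMeasure (fundamentalRep (Fin 3)) (reg.β k) : Measure (GaugeConfig 4 (2 * S + 1) (Matrix.specialUnitaryGroup (Fin 3) ℂ)))) /
                (∫ U, (∏ f, ‖fermionDet (wilsonDirac (fundamentalRep (Fin 3)) U (reg.mcrit k + reg.a k * m f / reg.Zm k) 1)‖)
                  ∂(wilsonMeasure (fundamentalRep (Fin 3)) (reg.β k) : Measure (GaugeConfig 4 (2 * S + 1) (Matrix.specialUnitaryGroup (Fin 3) ℂ))))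
              ≤ δ j * Real.log 2)) :
    (∀ ε : ℝ, 0 < ε → ∀ᶠ k : ℕ in Filter.atTop, ∀ S : ℕ, R ≤ reg.a k * (2 * S + 1) →
          ∃ δ : ℕ → ℝ, (∀ j, 0 ≤ δ j) ∧
            ∑ j ∈ Finset.range (Nat.log 2 (⌊ℓ / reg.a k⌋₊ / b₀) + 1), δ j ≤ ε ∧
            ∀ j < Nat.log 2 (⌊ℓ / reg.a k⌋₊ / b₀) + 1, ∀ s : Fin 4 → ℕ,
              (∀ i, b₀ * 2 ^ j ≤ s i ∧ s i < b₀ * 2 ^ (j + 2) ∧ s i ≤ 2 * S + 1 ∧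
                (s i : ℝ) * reg.a k ≤ ℓ) →
              ∀ E : GaugeConfig 4 (2 * S + 1) (Matrix.specialUnitaryGroup (Fin 3) ℂ) → Prop,
                (∀ U, E U → ∃ f : Fin Nf, ∃ μ' : ℝ, reg.mcrit k + reg.a k * m f / reg.Zm k ≤ μ' ∧
                  ((wilsonCell U μ' 0 s).det = 0 ∨
                    ∃ c : Fin 4 → Bool, (wilsonCell U μ' (halfCorner s c) (halfSides s c)).det = 0)) →
                (∫ U, (if E U then (1 : ℝ) else 0) * (∏ f, ‖fermionDet (wilsonDirac (fundamentalRep (Fin 3)) U (reg.mcrit k + reg.a k * m f / reg.Zm k) 1)‖)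
                  ∂(wilsonMeasure (fundamentalRep (Fin 3)) (reg.β k) : Measure (GaugeConfig 4 (2 * S + 1) (Matrix.specialUnitaryGroup (Fin 3) ℂ)))) /
                (∫ U, (∏ f, ‖fermionDet (wilsonDirac (fundamentalRep (Fin 3)) U (reg.mcrit k + reg.a k * m f / reg.Zm k) 1)‖)
                  ∂(wilsonMeasure (fundamentalRep (Fin 3)) (reg.β k) : Measure (GaugeConfig 4 (2 * S + 1) (Matrix.specialUnitaryGroup (Fin 3) ℂ)))) ≤ δ j) := by
  intro ε hε
  filter_upwards [hJL ε hε] with k hk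
  intro S hS
  obtain ⟨δ, hδ0, hδs, hδ⟩ := hk S hS
  refine ⟨δ, hδ0, hδs, ?_⟩
  intro j hj s hs E hE
  obtain ⟨r, hr, hbound⟩ := hδ j hj s hs
  -- abbreviations
  have hr2 : ∀ f, 0 < 2 * r f := fun f => by linarith [hr f]
  have hrR : ∀ f, r f < 2 * r f := fun f => by linarith [hr f]
  have hlog2 : ∀ f, Real.log (2 * r f / r f) = Real.log 2 := fun f => by
    rw [mul_div_assoc, div_self (hr f).ne', mul_one]
  have hlog2pos : 0 < Real.log 2 := Real.log_pos (by norm_num)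
  -- the weight: continuous on a compact space, hence measurable, bounded, and it is non-negative
  have hwt_cont : Continuous fun U : GaugeConfig 4 (2 * S + 1) (Matrix.specialUnitaryGroup (Fin 3) ℂ) =>
      ∏ f, ‖fermionDet (wilsonDirac (fundamentalRep (Fin 3)) U
        (reg.mcrit k + reg.a k * m f / reg.Zm k) 1)‖ :=
    continuous_finsetProd _ fun f _ =>
      ((continuous_wilsonDirac (fundamentalRep (Fin 3)) (continuous_fundamentalRep (Fin 3)) _ _).matrix_det).norm
  have hwt0 : ∀ U : GaugeConfig 4 (2 * S + 1) (Matrix.specialUnitaryGroup (Fin 3) ℂ),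
      0 ≤ ∏ f, ‖fermionDet (wilsonDirac (fundamentalRep (Fin 3)) U
        (reg.mcrit k + reg.a k * m f / reg.Zm k) 1)‖ :=
    fun U => Finset.prod_nonneg fun f _ => norm_nonneg _
  obtain ⟨Cw, hCw⟩ : ∃ Cw : ℝ, ∀ U : GaugeConfig 4 (2 * S + 1) (Matrix.specialUnitaryGroup (Fin 3) ℂ),
      ∏ f, ‖fermionDet (wilsonDirac (fundamentalRep (Fin 3)) U
        (reg.mcrit k + reg.a k * m f / reg.Zm k) 1)‖ ≤ Cw := by
    obtain ⟨U₀, -, hU₀⟩ := (isCompact_univ (X := GaugeConfig 4 (2 * S + 1) (Matrix.specialUnitaryGroup (Fin 3) ℂ))).exists_isMaxOn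
      Set.univ_nonempty hwt_cont.continuousOn
    exact ⟨_, fun U => hU₀ (Set.mem_univ U)⟩
  -- the charge functional: measurable, non-negative, bounded (stub 2)
  have hJ := fun (x : TorusSite 4 (2 * S + 1)) (s' : Fin 4 → ℕ) (c : ℝ) (f : Fin Nf) =>
    stub_excessRegular (2 * S + 1) x s' c (r f) (2 * r f) (hr f) (hrR f)
  refine outerProb_le_of_charge
    (wilsonMeasure (d := 4) (L := 2 * S + 1) (fundamentalRep (Fin 3)) (reg.β k))
    (fun U => ∏ f, ‖fermionDet (wilsonDirac (fundamentalRep (Fin 3)) U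
      (reg.mcrit k + reg.a k * m f / reg.Zm k) 1)‖)
    (fun U => ∑ f, ∑ n ∈ Finset.range (⌊-(reg.mcrit k + reg.a k * m f / reg.Zm k) / (2 * r f)⌋₊ + 1),
      ((Real.circleAverage (fun z : ℂ => Real.log ‖((wilsonCell U 0 0 s).charpoly).eval z‖)
            (((2 * (n : ℝ) + 1) * r f : ℝ) : ℂ) (2 * r f)
          - Real.circleAverage (fun z : ℂ => Real.log ‖((wilsonCell U 0 0 s).charpoly).eval z‖)
            (((2 * (n : ℝ) + 1) * r f : ℝ) : ℂ) (r f)) +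
        ∑ ε : Fin 4 → Bool,
          (Real.circleAverage
              (fun z : ℂ => Real.log ‖((wilsonCell U 0 (halfCorner s ε) (halfSides s ε)).charpoly).eval z‖)
              (((2 * (n : ℝ) + 1) * r f : ℝ) : ℂ) (2 * r f)
            - Real.circleAverage
              (fun z : ℂ => Real.log ‖((wilsonCell U 0 (halfCorner s ε) (halfSides s ε)).charpoly).eval z‖)
              (((2 * (n : ℝ) + 1) * r f : ℝ) : ℂ) (r f))))
    hwt_cont.measurable hwt0 Cw hCw ?_ ?_
    (∑ f, ∑ n ∈ Finset.range (⌊-(reg.mcrit k + reg.a k * m f / reg.Zm k) / (2 * r f)⌋₊ + 1),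
      ((Fintype.card {p // wilsonBox (0 : TorusSite 4 (2 * S + 1)) s p} : ℝ) * Real.log (2 * r f / r f) +
        ∑ ε : Fin 4 → Bool,
          (Fintype.card {p // wilsonBox (halfCorner s ε : TorusSite 4 (2 * S + 1)) (halfSides s ε) p} : ℝ) *
            Real.log (2 * r f / r f)))
    ?_ E (Real.log 2) hlog2pos ?_ (δ j) hbound
  · -- measurability of the charge
    refine Finset.measurable_sum _ fun f _ => Finset.measurable_sum _ fun n _ => ?_
    refine Measurable.add (hJ 0 s _ f).1 (Finset.measurable_sum _ fun ε _ => ?_)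
    exact (hJ (halfCorner s ε) (halfSides s ε) _ f).1
  · -- non-negativity of the charge
    intro U
    refine Finset.sum_nonneg fun f _ => Finset.sum_nonneg fun n _ => add_nonneg ?_ ?_
    · exact ((hJ 0 s _ f).2 U).1
    · exact Finset.sum_nonneg fun ε _ => ((hJ (halfCorner s ε) (halfSides s ε) _ f).2 U).1
  · -- boundedness of the charge
    intro U
    refine Finset.sum_le_sum fun f _ => Finset.sum_le_sum fun n _ => add_le_add ?_ ?_
    · exact ((hJ 0 s _ f).2 U).2
    · exact Finset.sum_le_sum fun ε _ => ((hJ (halfCorner s ε) (halfSides s ε) _ f).2 U).2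
  · -- every configuration of the cover event carries charge ≥ log 2
    intro U hU
    obtain ⟨f, μ', hμ'v, hsing⟩ := hE U hU
    -- the crossing lies at a non-positive bare mass (positivity domain, landed Negative lemma)
    have hμ'0 : μ' ≤ 0 := by
      by_contra hpos
      push Not at hpos
      rcases hsing with h | ⟨c₀, h⟩
      · exact Summit.QuantumFields.QCD.Theorems.EarlyCrosserLawNegative.wilsonCell_det_ne_zero_of_pos
          U hpos _ _ h
      · exact Summit.QuantumFields.QCD.Theorems.EarlyCrosserLawNegative.wilsonCell_det_ne_zero_of_pos
          U hpos _ _ h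
    -- the grid disc containing −μ'
    set t : ℝ := -μ' with ht
    have ht0 : 0 ≤ t := by linarith
    have htv : t ≤ -(reg.mcrit k + reg.a k * m f / reg.Zm k) := by linarith
    set n : ℕ := ⌊t / (2 * r f)⌋₊ with hn
    have hn_mem : n ∈ Finset.range (⌊-(reg.mcrit k + reg.a k * m f / reg.Zm k) / (2 * r f)⌋₊ + 1) := by
      rw [Finset.mem_range, Nat.lt_add_one_iff]
      exact Nat.floor_mono (div_le_div_of_nonneg_right htv (hr2 f).le)
    have hn_le : (n : ℝ) ≤ t / (2 * r f) := Nat.floor_le (div_nonneg ht0 (hr2 f).le)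
    have hn_lt : t / (2 * r f) < n + 1 := Nat.lt_floor_add_one _
    have hcentre : |μ' + (2 * (n : ℝ) + 1) * r f| ≤ r f := by
      have h1 : (n : ℝ) * (2 * r f) ≤ t := (le_div_iff₀ (hr2 f)).mp hn_le
      have h2 : t < ((n : ℝ) + 1) * (2 * r f) := (div_lt_iff₀ (hr2 f)).mp hn_lt
      rw [abs_le]
      constructor
      · linarith
      · linarith
    -- the charged term
    have hterm : Real.log 2 ≤
        (Real.circleAverage (fun z : ℂ => Real.log ‖((wilsonCell U 0 0 s).charpoly).eval z‖)
              (((2 * (n : ℝ) + 1) * r f : ℝ) : ℂ) (2 * r f)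
            - Real.circleAverage (fun z : ℂ => Real.log ‖((wilsonCell U 0 0 s).charpoly).eval z‖)
              (((2 * (n : ℝ) + 1) * r f : ℝ) : ℂ) (r f)) +
          ∑ ε : Fin 4 → Bool,
            (Real.circleAverage
                (fun z : ℂ => Real.log ‖((wilsonCell U 0 (halfCorner s ε) (halfSides s ε)).charpoly).eval z‖)
                (((2 * (n : ℝ) + 1) * r f : ℝ) : ℂ) (2 * r f)
              - Real.circleAverage
                (fun z : ℂ => Real.log ‖((wilsonCell U 0 (halfCorner s ε) (halfSides s ε)).charpoly).eval z‖)
                (((2 * (n : ℝ) + 1) * r f : ℝ) : ℂ) (r f)) := by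
      rcases hsing with hpar | ⟨c₀, hchild⟩
      · have h1 := stub_crossingCharge (2 * S + 1) U 0 s μ' ((2 * (n : ℝ) + 1) * r f) (r f) (2 * r f) (hr f) (hrR f)
          hpar hcentre
        rw [hlog2 f] at h1
        exact le_add_of_le_of_nonneg h1
          (Finset.sum_nonneg fun ε _ => ((hJ (halfCorner s ε) (halfSides s ε) _ f).2 U).1)
      · have h1 := stub_crossingCharge (2 * S + 1) U (halfCorner s c₀) (halfSides s c₀) μ' ((2 * (n : ℝ) + 1) * r f)
          (r f) (2 * r f) (hr f) (hrR f) hchild hcentre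
        rw [hlog2 f] at h1
        refine le_add_of_nonneg_of_le ((hJ 0 s _ f).2 U).1 (h1.trans ?_)
        exact Finset.single_le_sum
          (f := fun ε : Fin 4 → Bool =>
            Real.circleAverage
                (fun z : ℂ => Real.log ‖((wilsonCell U 0 (halfCorner s ε) (halfSides s ε)).charpoly).eval z‖)
                (((2 * (n : ℝ) + 1) * r f : ℝ) : ℂ) (2 * r f)
              - Real.circleAverage
                (fun z : ℂ => Real.log ‖((wilsonCell U 0 (halfCorner s ε) (halfSides s ε)).charpoly).eval z‖)
                (((2 * (n : ℝ) + 1) * r f : ℝ) : ℂ) (r f))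
          (fun ε _ => ((hJ (halfCorner s ε) (halfSides s ε) _ f).2 U).1) (Finset.mem_univ c₀)
    -- sum over the grid and the flavours
    refine hterm.trans ?_
    refine le_trans ?_ (Finset.single_le_sum (f := fun f' : Fin Nf =>
        ∑ n ∈ Finset.range (⌊-(reg.mcrit k + reg.a k * m f' / reg.Zm k) / (2 * r f')⌋₊ + 1),
          ((Real.circleAverage (fun z : ℂ => Real.log ‖((wilsonCell U 0 0 s).charpoly).eval z‖)
                (((2 * (n : ℝ) + 1) * r f' : ℝ) : ℂ) (2 * r f')
              - Real.circleAverage (fun z : ℂ => Real.log ‖((wilsonCell U 0 0 s).charpoly).eval z‖)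
                (((2 * (n : ℝ) + 1) * r f' : ℝ) : ℂ) (r f')) +
            ∑ ε : Fin 4 → Bool,
              (Real.circleAverage
                  (fun z : ℂ => Real.log ‖((wilsonCell U 0 (halfCorner s ε) (halfSides s ε)).charpoly).eval z‖)
                  (((2 * (n : ℝ) + 1) * r f' : ℝ) : ℂ) (2 * r f')
                - Real.circleAverage
                  (fun z : ℂ => Real.log ‖((wilsonCell U 0 (halfCorner s ε) (halfSides s ε)).charpoly).eval z‖)
                  (((2 * (n : ℝ) + 1) * r f' : ℝ) : ℂ) (r f'))))
      (fun f' _ => Finset.sum_nonneg fun n _ => add_nonneg ((hJ 0 s _ f').2 U).1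
        (Finset.sum_nonneg fun ε _ => ((hJ (halfCorner s ε) (halfSides s ε) _ f').2 U).1))
      (Finset.mem_univ f))
    exact Finset.single_le_sum (f := fun n : ℕ =>
        (Real.circleAverage (fun z : ℂ => Real.log ‖((wilsonCell U 0 0 s).charpoly).eval z‖)
              (((2 * (n : ℝ) + 1) * r f : ℝ) : ℂ) (2 * r f)
            - Real.circleAverage (fun z : ℂ => Real.log ‖((wilsonCell U 0 0 s).charpoly).eval z‖)
              (((2 * (n : ℝ) + 1) * r f : ℝ) : ℂ) (r f)) +
          ∑ ε : Fin 4 → Bool,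
            (Real.circleAverage
                (fun z : ℂ => Real.log ‖((wilsonCell U 0 (halfCorner s ε) (halfSides s ε)).charpoly).eval z‖)
                (((2 * (n : ℝ) + 1) * r f : ℝ) : ℂ) (2 * r f)
              - Real.circleAverage
                (fun z : ℂ => Real.log ‖((wilsonCell U 0 (halfCorner s ε) (halfSides s ε)).charpoly).eval z‖)
                (((2 * (n : ℝ) + 1) * r f : ℝ) : ℂ) (r f)))
      (fun n _ => add_nonneg ((hJ 0 s _ f).2 U).1
        (Finset.sum_nonneg fun ε _ => ((hJ (halfCorner s ε) (halfSides s ε) _ f).2 U).1))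
      hn_mem

/-! ## Form A: the registered cut (shared pin + ∀-reg Jensen dilution) -/

/-- **The crux from the two physics statements, Form A** (hypotheses = the registered stub signatures `stub_pinnedLine`,
`stub_jensenDilution` verbatim): re-base `M₀ ↦ M₀ + C`, thread the pins (guard `M₀ < M`), get (a′) from `dilution_of_jensenLaw`. -/
theorem EarlyCrosserLaw_of_pinnedLine_of_jensenDilution
    (hPin : ∀ Nf : ℕ, (Nf = 2 ∨ Nf = 3) → ∃ reg : QCDRegularisation Nf, reg.HasMassScaling ∧
      (reg.scheme 0 0 0).HasAsymptoticScaling ∧ ∃ M₀ : ℝ, 0 ≤ M₀ ∧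
      ∀ m : Fin Nf → ℝ, (∀ f, M₀ < m f) → ∃ R : ℝ, 0 < R ∧
        (∀ M : ℝ, M₀ < M → ∀ᶠ k : ℕ in Filter.atTop, ∀ S : ℕ, R ≤ reg.a k * (2 * S + 1) →
          (1 / 4 : ℝ) ≤ (∫ U, (if (fermionDet (wilsonDirac (fundamentalRep (Fin 3)) U (reg.mcrit k - reg.a k * M / reg.Zm k) 1)).re < 0 then (1 : ℝ) else 0) * (∏ f, ‖fermionDet (wilsonDirac (fundamentalRep (Fin 3)) U (reg.mcrit k + reg.a k * m f / reg.Zm k) 1)‖) ∂(wilsonMeasure (fundamentalRep (Fin 3)) (reg.β k) : Measure (GaugeConfig 4 (2 * S + 1) (Matrix.specialUnitaryGroup (Fin 3) ℂ)))) /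
            (∫ U, (∏ f, ‖fermionDet (wilsonDirac (fundamentalRep (Fin 3)) U (reg.mcrit k + reg.a k * m f / reg.Zm k) 1)‖) ∂(wilsonMeasure (fundamentalRep (Fin 3)) (reg.β k) : Measure (GaugeConfig 4 (2 * S + 1) (Matrix.specialUnitaryGroup (Fin 3) ℂ))))) ∧
        (∀ M : ℝ, M₀ < M → ∀ᶠ k : ℕ in Filter.atTop, ∀ S : ℕ, R ≤ reg.a k * (2 * S + 1) → reg.a k * (2 * S + 1) ≤ 2 * R →
          (∫ U, (if (fermionDet (wilsonDirac (fundamentalRep (Fin 3)) U (reg.mcrit k + reg.a k * M / reg.Zm k) 1)).re < 0 then (1 : ℝ) else 0) * (∏ f, ‖fermionDet (wilsonDirac (fundamentalRep (Fin 3)) U (reg.mcrit k + reg.a k * m f / reg.Zm k) 1)‖) ∂(wilsonMeasure (fundamentalRep (Fin 3)) (reg.β k) : Measure (GaugeConfig 4 (2 * S + 1) (Matrix.specialUnitaryGroup (Fin 3) ℂ)))) /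
            (∫ U, (∏ f, ‖fermionDet (wilsonDirac (fundamentalRep (Fin 3)) U (reg.mcrit k + reg.a k * m f / reg.Zm k) 1)‖) ∂(wilsonMeasure (fundamentalRep (Fin 3)) (reg.β k) : Measure (GaugeConfig 4 (2 * S + 1) (Matrix.specialUnitaryGroup (Fin 3) ℂ)))) ≤ (1 / 8 : ℝ)))
    (hDil : ∀ Nf : ℕ, (Nf = 2 ∨ Nf = 3) → ∀ reg : QCDRegularisation Nf, reg.HasMassScaling →
      (reg.scheme 0 0 0).HasAsymptoticScaling →
      ∃ b₀ : ℕ, 2 ≤ b₀ ∧ ∃ ℓ : ℝ, 0 < ℓ ∧ ∃ C : ℝ, 0 ≤ C ∧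
      ∀ M₀ : ℝ, 0 ≤ M₀ → ∀ m : Fin Nf → ℝ, (∀ f, M₀ + C < m f) → ∀ R : ℝ, 0 < R →
        (∀ M : ℝ, M₀ < M → ∀ᶠ k : ℕ in Filter.atTop, ∀ S : ℕ, R ≤ reg.a k * (2 * S + 1) →
          (1 / 4 : ℝ) ≤ (∫ U, (if (fermionDet (wilsonDirac (fundamentalRep (Fin 3)) U (reg.mcrit k - reg.a k * M / reg.Zm k) 1)).re < 0 then (1 : ℝ) else 0) * (∏ f, ‖fermionDet (wilsonDirac (fundamentalRep (Fin 3)) U (reg.mcrit k + reg.a k * m f / reg.Zm k) 1)‖) ∂(wilsonMeasure (fundamentalRep (Fin 3)) (reg.β k) : Measure (GaugeConfig 4 (2 * S + 1) (Matrix.specialUnitaryGroup (Fin 3) ℂ)))) /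
            (∫ U, (∏ f, ‖fermionDet (wilsonDirac (fundamentalRep (Fin 3)) U (reg.mcrit k + reg.a k * m f / reg.Zm k) 1)‖) ∂(wilsonMeasure (fundamentalRep (Fin 3)) (reg.β k) : Measure (GaugeConfig 4 (2 * S + 1) (Matrix.specialUnitaryGroup (Fin 3) ℂ))))) →
        (∀ M : ℝ, M₀ < M → ∀ᶠ k : ℕ in Filter.atTop, ∀ S : ℕ, R ≤ reg.a k * (2 * S + 1) → reg.a k * (2 * S + 1) ≤ 2 * R →
          (∫ U, (if (fermionDet (wilsonDirac (fundamentalRep (Fin 3)) U (reg.mcrit k + reg.a k * M / reg.Zm k) 1)).re < 0 then (1 : ℝ) else 0) * (∏ f, ‖fermionDet (wilsonDirac (fundamentalRep (Fin 3)) U (reg.mcrit k + reg.a k * m f / reg.Zm k) 1)‖) ∂(wilsonMeasure (fundamentalRep (Fin 3)) (reg.β k) : Measure (GaugeConfig 4 (2 * S + 1) (Matrix.specialUnitaryGroup (Fin 3) ℂ)))) /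
            (∫ U, (∏ f, ‖fermionDet (wilsonDirac (fundamentalRep (Fin 3)) U (reg.mcrit k + reg.a k * m f / reg.Zm k) 1)‖) ∂(wilsonMeasure (fundamentalRep (Fin 3)) (reg.β k) : Measure (GaugeConfig 4 (2 * S + 1) (Matrix.specialUnitaryGroup (Fin 3) ℂ)))) ≤ (1 / 8 : ℝ)) →
        (∀ ε : ℝ, 0 < ε → ∀ᶠ k : ℕ in Filter.atTop, ∀ S : ℕ, R ≤ reg.a k * (2 * S + 1) →
          ∃ δ : ℕ → ℝ, (∀ j, 0 ≤ δ j) ∧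
            ∑ j ∈ Finset.range (Nat.log 2 (⌊ℓ / reg.a k⌋₊ / b₀) + 1), δ j ≤ ε ∧
            ∀ j < Nat.log 2 (⌊ℓ / reg.a k⌋₊ / b₀) + 1, ∀ s : Fin 4 → ℕ,
              (∀ i, b₀ * 2 ^ j ≤ s i ∧ s i < b₀ * 2 ^ (j + 2) ∧ s i ≤ 2 * S + 1 ∧
                (s i : ℝ) * reg.a k ≤ ℓ) →
              ∃ r : Fin Nf → ℝ, (∀ f, 0 < r f) ∧
                (∫ U, (∑ f, ∑ n ∈ Finset.range
                    (⌊(-(reg.mcrit k + reg.a k * m f / reg.Zm k)) / (2 * r f)⌋₊ + 1),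
                    ((Real.circleAverage (fun z : ℂ => Real.log ‖((wilsonCell U 0 (0 : TorusSite 4 (2 * S + 1)) s).charpoly).eval z‖)
                        ((((2 * (n : ℝ) + 1) * r f : ℝ)) : ℂ) (2 * r f)
                      - Real.circleAverage (fun z : ℂ => Real.log ‖((wilsonCell U 0 (0 : TorusSite 4 (2 * S + 1)) s).charpoly).eval z‖)
                        ((((2 * (n : ℝ) + 1) * r f : ℝ)) : ℂ) (r f)) +
                      ∑ ε : Fin 4 → Bool,
                        (Real.circleAverage (fun z : ℂ => Real.log ‖((wilsonCell U 0 (halfCorner s ε) (halfSides s ε)).charpoly).eval z‖)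
                        ((((2 * (n : ℝ) + 1) * r f : ℝ)) : ℂ) (2 * r f)
                      - Real.circleAverage (fun z : ℂ => Real.log ‖((wilsonCell U 0 (halfCorner s ε) (halfSides s ε)).charpoly).eval z‖)
                        ((((2 * (n : ℝ) + 1) * r f : ℝ)) : ℂ) (r f)))) *
                    (∏ f, ‖fermionDet (wilsonDirac (fundamentalRep (Fin 3)) U (reg.mcrit k + reg.a k * m f / reg.Zm k) 1)‖)
                  ∂(wilsonMeasure (fundamentalRep (Fin 3)) (reg.β k) : Measure (GaugeConfig 4 (2 * S + 1) (Matrix.specialUnitaryGroup (Fin 3) ℂ)))) /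
                (∫ U, (∏ f, ‖fermionDet (wilsonDirac (fundamentalRep (Fin 3)) U (reg.mcrit k + reg.a k * m f / reg.Zm k) 1)‖)
                  ∂(wilsonMeasure (fundamentalRep (Fin 3)) (reg.β k) : Measure (GaugeConfig 4 (2 * S + 1) (Matrix.specialUnitaryGroup (Fin 3) ℂ))))
              ≤ δ j * Real.log 2)) :
    EarlyCrosserLaw := by
  intro Nf hNf
  obtain ⟨reg, hms, has, M₀, hM₀, hm⟩ := hPin Nf hNf
  obtain ⟨b₀, hb₀, ℓ, hℓ, C, hC0, hdil⟩ := hDil Nf hNf reg hms has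
  refine ⟨reg, hms, has, M₀ + C, by linarith, b₀, hb₀, ℓ, hℓ, fun m hmm => ?_⟩
  have hmm₀ : ∀ f, M₀ < m f := fun f => by have := hmm f; linarith
  obtain ⟨R, hR, hB, hB2⟩ := hm m hmm₀
  refine ⟨R, hR, ?_, fun M hM => hB M (by linarith), fun M hM => hB2 M (by linarith)⟩
  exact dilution_of_jensenLaw reg b₀ ℓ m R (hdil M₀ hM₀ m hmm R hR hB hB2)

/-! ## Form B: the ∃-merged cut (one regularisation carries pins and Jensen law) -/

/-- **The crux from ONE merged physics statement, Form B** (`PinnedJensen`: one admissible regularisation, `M₀`, `b₀`,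
`ℓ`, and for every mass tuple above `M₀` one `R` serving (b), (b″) AND the Jensen law): the prover of this form may DEFINE
`m_crit(k)` as the parity-jump line and never needs its uniqueness; the crux follows via `dilution_of_jensenLaw`. -/
theorem EarlyCrosserLaw_of_pinnedJensen
    (h : ∀ Nf : ℕ, (Nf = 2 ∨ Nf = 3) → ∃ reg : QCDRegularisation Nf, reg.HasMassScaling ∧
      (reg.scheme 0 0 0).HasAsymptoticScaling ∧ ∃ M₀ : ℝ, 0 ≤ M₀ ∧ ∃ b₀ : ℕ, 2 ≤ b₀ ∧ ∃ ℓ : ℝ, 0 < ℓ ∧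
      ∀ m : Fin Nf → ℝ, (∀ f, M₀ < m f) → ∃ R : ℝ, 0 < R ∧
        (∀ M : ℝ, M₀ < M → ∀ᶠ k : ℕ in Filter.atTop, ∀ S : ℕ, R ≤ reg.a k * (2 * S + 1) →
          (1 / 4 : ℝ) ≤ (∫ U, (if (fermionDet (wilsonDirac (fundamentalRep (Fin 3)) U (reg.mcrit k - reg.a k * M / reg.Zm k) 1)).re < 0 then (1 : ℝ) else 0) * (∏ f, ‖fermionDet (wilsonDirac (fundamentalRep (Fin 3)) U (reg.mcrit k + reg.a k * m f / reg.Zm k) 1)‖) ∂(wilsonMeasure (fundamentalRep (Fin 3)) (reg.β k) : Measure (GaugeConfig 4 (2 * S + 1) (Matrix.specialUnitaryGroup (Fin 3) ℂ)))) /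
            (∫ U, (∏ f, ‖fermionDet (wilsonDirac (fundamentalRep (Fin 3)) U (reg.mcrit k + reg.a k * m f / reg.Zm k) 1)‖) ∂(wilsonMeasure (fundamentalRep (Fin 3)) (reg.β k) : Measure (GaugeConfig 4 (2 * S + 1) (Matrix.specialUnitaryGroup (Fin 3) ℂ))))) ∧
        (∀ M : ℝ, M₀ < M → ∀ᶠ k : ℕ in Filter.atTop, ∀ S : ℕ, R ≤ reg.a k * (2 * S + 1) → reg.a k * (2 * S + 1) ≤ 2 * R →
          (∫ U, (if (fermionDet (wilsonDirac (fundamentalRep (Fin 3)) U (reg.mcrit k + reg.a k * M / reg.Zm k) 1)).re < 0 then (1 : ℝ) else 0) * (∏ f, ‖fermionDet (wilsonDirac (fundamentalRep (Fin 3)) U (reg.mcrit k + reg.a k * m f / reg.Zm k) 1)‖) ∂(wilsonMeasure (fundamentalRep (Fin 3)) (reg.β k) : Measure (GaugeConfig 4 (2 * S + 1) (Matrix.specialUnitaryGroup (Fin 3) ℂ)))) /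
            (∫ U, (∏ f, ‖fermionDet (wilsonDirac (fundamentalRep (Fin 3)) U (reg.mcrit k + reg.a k * m f / reg.Zm k) 1)‖) ∂(wilsonMeasure (fundamentalRep (Fin 3)) (reg.β k) : Measure (GaugeConfig 4 (2 * S + 1) (Matrix.specialUnitaryGroup (Fin 3) ℂ)))) ≤ (1 / 8 : ℝ)) ∧
        (∀ ε : ℝ, 0 < ε → ∀ᶠ k : ℕ in Filter.atTop, ∀ S : ℕ, R ≤ reg.a k * (2 * S + 1) →
          ∃ δ : ℕ → ℝ, (∀ j, 0 ≤ δ j) ∧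
            ∑ j ∈ Finset.range (Nat.log 2 (⌊ℓ / reg.a k⌋₊ / b₀) + 1), δ j ≤ ε ∧
            ∀ j < Nat.log 2 (⌊ℓ / reg.a k⌋₊ / b₀) + 1, ∀ s : Fin 4 → ℕ,
              (∀ i, b₀ * 2 ^ j ≤ s i ∧ s i < b₀ * 2 ^ (j + 2) ∧ s i ≤ 2 * S + 1 ∧
                (s i : ℝ) * reg.a k ≤ ℓ) →
              ∃ r : Fin Nf → ℝ, (∀ f, 0 < r f) ∧
                (∫ U, (∑ f, ∑ n ∈ Finset.range
                    (⌊(-(reg.mcrit k + reg.a k * m f / reg.Zm k)) / (2 * r f)⌋₊ + 1),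
                    ((Real.circleAverage (fun z : ℂ => Real.log ‖((wilsonCell U 0 (0 : TorusSite 4 (2 * S + 1)) s).charpoly).eval z‖)
                        ((((2 * (n : ℝ) + 1) * r f : ℝ)) : ℂ) (2 * r f)
                      - Real.circleAverage (fun z : ℂ => Real.log ‖((wilsonCell U 0 (0 : TorusSite 4 (2 * S + 1)) s).charpoly).eval z‖)
                        ((((2 * (n : ℝ) + 1) * r f : ℝ)) : ℂ) (r f)) +
                      ∑ ε : Fin 4 → Bool,
                        (Real.circleAverage (fun z : ℂ => Real.log ‖((wilsonCell U 0 (halfCorner s ε) (halfSides s ε)).charpoly).eval z‖)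
                        ((((2 * (n : ℝ) + 1) * r f : ℝ)) : ℂ) (2 * r f)
                      - Real.circleAverage (fun z : ℂ => Real.log ‖((wilsonCell U 0 (halfCorner s ε) (halfSides s ε)).charpoly).eval z‖)
                        ((((2 * (n : ℝ) + 1) * r f : ℝ)) : ℂ) (r f)))) *
                    (∏ f, ‖fermionDet (wilsonDirac (fundamentalRep (Fin 3)) U (reg.mcrit k + reg.a k * m f / reg.Zm k) 1)‖)
                  ∂(wilsonMeasure (fundamentalRep (Fin 3)) (reg.β k) : Measure (GaugeConfig 4 (2 * S + 1) (Matrix.specialUnitaryGroup (Fin 3) ℂ)))) /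
                (∫ U, (∏ f, ‖fermionDet (wilsonDirac (fundamentalRep (Fin 3)) U (reg.mcrit k + reg.a k * m f / reg.Zm k) 1)‖)
                  ∂(wilsonMeasure (fundamentalRep (Fin 3)) (reg.β k) : Measure (GaugeConfig 4 (2 * S + 1) (Matrix.specialUnitaryGroup (Fin 3) ℂ))))
              ≤ δ j * Real.log 2)) :
    EarlyCrosserLaw := by
  intro Nf hNf
  obtain ⟨reg, hms, has, M₀, hM₀, b₀, hb₀, ℓ, hℓ, hm⟩ := h Nf hNf
  refine ⟨reg, hms, has, M₀, hM₀, b₀, hb₀, ℓ, hℓ, fun m hmm => ?_⟩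
  obtain ⟨R, hR, hB, hB2, hJ⟩ := hm m hmm
  exact ⟨R, hR, dilution_of_jensenLaw reg b₀ ℓ m R hJ, hB, hB2⟩

end Summit.QuantumFields.QCD.Cruxes.EarlyCrosserLaw.AccretiveCoarseJensen

end
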